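import Summits.BirchSwinnertonDyer.Rank1Residual.GaloisImage.TorsionLevelTwoDevissageLocal
import Summits.BirchSwinnertonDyer.Rank1Residual.GaloisImage.KolyvaginScalarTransportLocal
import HarnessLib

/-!
# The pair `E[3] ↪ E[3^{k+2}] ↠ E[3^{k+1}]` for EVERY `k`: short exact sequence, `H¹`, Selmer
# push-forward, local injectivity and matched bases — the inputs of the injectivity dévissage
# `m = k + 1 ⟹ m = k + 2` (cell `b2b-bsdres`, team n1011, row T-INJ-DEV-K = the all-depth half of
# row T-INJ-DEV; seat p11 GEN 6; lead R5-69 (b)/(c); skeleton `cells/n1011/skel/T-INJ-DEV-FB.md`)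

HONEST FRAMING (cell `b2b-bsdres`, run/shared/lean/b2b/bsd-rank1-residual/, verbatim in every
file): the goal of the cell is to DELETE the COMBINATION-SHAPED residual classes of the
Birch–Swinnerton-Dyer formula for ALL analytic-rank `≤ 1` elliptic curves over `ℚ` — "full BSD
formula for every rank `≤ 1` curve in class `C`" assembled STRICTLY from published theorems — so
that the rank-`≤ 1` remainder becomes exactly the CONSTRUCTION-SHAPED classes, which are TYPED
(missing-input `Prop`s), NOT attempted. This is not "finishing BSD". Team n1011 (N10 / N11, the
additive block X4 ∧ `p = 3`): research route on the CONSTRUCTION-SHAPED class X4; TOOL theorems; no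
class theorem; nothing is booked; no label and no RESIDUAL-MAP mark is moved. Theorems only: no
definition, no named fact, no `sorry`.

## What and why

n1011-p15's dévissage (`KSDevissage.apply_eq_zero_of_apply_eq_zero_of_devissage`, file F-A) and its
level-two instance (`TorsionLevelTwoDevissageLocal`, F-B2a: `E[3] ↪ E[9] ↠ E[3]`) give the injectivity
of evaluation on Kolyvagin systems of `E[9]` from the `m = 1` injectivity (R1-56 (G) / R1-58).  This
file supplies the same inputs ONE LEVEL UP FOR EVERY `k`: the sequence
`0 → E[3] →(incl) E[3^{k+1}·3] →(red) E[3^k·3] → 0`, where `red` is ANY equivariant map which is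
multiplication by `3` on geometric points (a BINDER with a pointwise specification — the tree's
constructor is n1011-p11's `exists_torsionReduction_pow_mul 3 k (k+1)`; no level-spelling transport):

* §1 `isSES_torsionInclusion_red` and its `H¹` consequences over `ℚ` (`hexact`, `hinji`);
* §2 the Selmer structures: `red_*` maps `𝓕_can(E[3^{k+1}·3])` into `𝓕_can(E[3^k·3])`
  (`localMap_red_mem_propagatedSelmerStructure`, via n1011-p11 GEN 3 `Transport.localMap_red_tateLocalMap`:
  `red ∘ π_{k+2} = π_{k+1}` on `T_3E`); `𝓕̄_can ⊇ incl_*⁻¹ 𝓕_can` = n1011-p13's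
  `isCartesianAt_propagatedSelmerStructure` + `induced_propagatedSelmerStructure` (restated in F-A's
  shape); both structures unramified at good primes `∤ 3`;
* §3 LOCAL injectivity of `incl_* : H¹(ℚ_q, E[3]) → H¹(ℚ_q, E[3^{k+1}·3])` at a prime where
  `#H⁰(ℚ_q, E[3^{k+1}·3]) = 3^{k+2}`, `#H⁰(ℚ_q, E[3^k·3]) = 3^{k+1}`, `#H⁰(ℚ_q, E[3]) = 3` (a Kolyvagin
  prime of level `3^{k+2}`): `red` maps invariants ONTO invariants, so `δ₀ = 0` (n1011-p15's counting
  at `k = 0`, verbatim one level up);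
* §4 matched bases: a `ℤ/3^{k+2}`-basis of `E[3^{k+1}·3]` maps under `red` to a `ℤ/3^{k+1}`-basis of
  `E[3^k·3]` and under `[3^{k+1}]` to an `𝔽₃`-basis of `E[3]` (the basis hypotheses of n1011-p15's
  `singularMap_localMap_eq_fs_of_hasCanonicalComparison` / `…_of_localMap_…`).
The assembly (F-A instantiated one level up, and the induction over all depths) is the sibling
`KolyvaginInjectivityAllDepths.lean`.

References: B. Mazur, K. Rubin, Mem. AMS 799 (2004) Thm. 4.4.1, §4.5 (induction on the length);
R. Sakamoto, JTNB 36 (2024) Def. 3.5, Thm. 4.4 (1) [Sakamoto2024]; K. Rubin, PCMI 18 (2011) §3.1,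
Prop. 1.4.13 [Rubin2011]; J. S. Milne, *ADT* I §6 (`0 → A_m → A_{mn} → A_n → 0`) [MilneADT2006].
-/

noncomputable section

open scoped Classical NumberField ContRepresentation
open Field NumberField IsDedekindDomain Module
open WeierstrassCurve Literature.NumberTheory.EllipticCurves Literature.NumberTheory.GaloisRepresentations
  Literature.NumberTheory.GaloisRepresentations.DiscreteGaloisModule Literature.NumberTheory.GaloisCohomology
open Summit.BirchSwinnertonDyer.Rank1Residual.GaloisImage.KSDevissage

namespace Summit.BirchSwinnertonDyer.Rank1Residual.GaloisImage.TorsionLevel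

variable (W : WeierstrassCurve ℚ) [W.IsElliptic] (k : ℕ)

/-- `3 ∣ 3^{k+1}·3` in `ℤ` (the inclusion `E[3] ⊆ E[3^{k+1}·3]`). [folklore] -/
theorem three_dvd_pow_succ_mul :
    ((3 : ℕ) : ℤ) ∣ ((3 : ℕ) : ℤ) ^ (k + 1) * ((3 : ℕ) : ℤ) :=
  Dvd.intro_left _ rfl

variable (red : (W.torsionGaloisModule (((3 : ℕ) : ℤ) ^ (k + 1) * ((3 : ℕ) : ℤ))).toContRepresentation →ⁱL
    (W.torsionGaloisModule (((3 : ℕ) : ℤ) ^ k * ((3 : ℕ) : ℤ))).toContRepresentation)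
  (hred : ∀ x : geomTorsion W (((3 : ℕ) : ℤ) ^ (k + 1) * ((3 : ℕ) : ℤ)),
    ((red x : geomTorsion W (((3 : ℕ) : ℤ) ^ k * ((3 : ℕ) : ℤ))) : geomPoints W) =
      ((3 : ℕ) : ℤ) • (x : geomPoints W))

/-! ### §1 The short exact sequence `0 → E[3] → E[3^{k+1}·3] → E[3^k·3] → 0` and `H¹` -/

omit [W.IsElliptic] in
include hred in
/-- **`0 → E[3] →(incl) E[3^{k+1}·3] →(red) E[3^k·3] → 0` is a short exact sequence of discrete
`Γ_ℚ`-modules** for any equivariant `red` which is `x ↦ 3x` on points (surjectivity = divisibility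
of `E(ℚ̄)`); Milne's `0 → A_m → A_{mn} →ᵐ A_n → 0`. [cite: MilneADT2006, Ch. I §6, proof of Prop. 6.9] -/
theorem isSES_torsionInclusion_red :
    IsSES (DiscreteGaloisModule.homOfIntertwining (W.torsionInclusion (three_dvd_pow_succ_mul k)))
      (DiscreteGaloisModule.homOfIntertwining red) where
  comp_eq_zero := by
    ext P
    have h := (mem_geomTorsion_iff W ((3 : ℕ) : ℤ) _).mp P.2
    change ((red (W.torsionInclusion (three_dvd_pow_succ_mul k) P) :
      geomTorsion W (((3 : ℕ) : ℤ) ^ k * ((3 : ℕ) : ℤ))) : geomPoints W) = 0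
    rw [hred, coe_torsionInclusion_apply]
    exact h
  injective := fun P Q h => Subtype.ext (congrArg Subtype.val h :)
  exact_mid := fun P hP => by
    have hP' : ((3 : ℕ) : ℤ) • (P : geomPoints W) = 0 := by
      rw [← hred]
      exact congrArg Subtype.val hP
    exact ⟨⟨P, (mem_geomTorsion_iff W _ _).mpr hP'⟩, rfl⟩
  surjective := fun Q => by
    have h3 : ((3 : ℕ) : ℤ) ≠ 0 := by norm_num
    obtain ⟨P, hP⟩ := W.zsmul_geomPoints_surjective_of_charZero h3 (Q : geomPoints W)
    have hP' : ((3 : ℕ) : ℤ) • P = (Q : geomPoints W) := hP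
    have hPmem : P ∈ geomTorsion W (((3 : ℕ) : ℤ) ^ (k + 1) * ((3 : ℕ) : ℤ)) := by
      rw [mem_geomTorsion_iff, mul_zsmul, hP', pow_succ]
      exact (mem_geomTorsion_iff W _ _).mp Q.2
    refine ⟨⟨P, hPmem⟩, Subtype.ext ?_⟩
    change ((red ⟨P, hPmem⟩ : geomTorsion W (((3 : ℕ) : ℤ) ^ k * ((3 : ℕ) : ℤ))) : geomPoints W) =
      (Q : geomPoints W)
    rw [hred]
    exact hP'

omit [W.IsElliptic] in
include hred in
/-- **Exactness at `H¹(ℚ, E[3^{k+1}·3])`**: a class killed by `red_*` comes from `H¹(ℚ, E[3])` (the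
hypothesis `hexact` of the dévissage). [cite: SerreGaloisCohomology1997, I §2.2] -/
theorem exists_map_torsionInclusion_eq_of_map_red_eq_zero
    (x : galoisCohomology (W.torsionGaloisModule (((3 : ℕ) : ℤ) ^ (k + 1) * ((3 : ℕ) : ℤ))) 1)
    (hx : galoisCohomology.map red 1 x = 0) :
    ∃ y, galoisCohomology.map (W.torsionInclusion (three_dvd_pow_succ_mul k)) 1 y = x :=
  (isSES_torsionInclusion_red W k red hred).exists_map_one_eq_of_map_one_eq_zero x hx

omit [W.IsElliptic] in
include hred in
/-- **`incl_* : H¹(ℚ, E[3]) → H¹(ℚ, E[3^{k+1}·3])` is injective when `E(ℚ̄)[3^k·3]^{Γ_ℚ} = 0`** (its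
kernel is `δ₀(H⁰(ℚ, E[3^k·3]))`; under surj(3) the hypothesis is n1011-p11's
`Transport.geomTorsion_eq_zero_of_fixed_of_surj`).  The hypothesis `hinji` of the dévissage.
[cite: SerreGaloisCohomology1997, I §2.2] -/
theorem map_torsionInclusion_injective
    (h0 : ∀ P : geomTorsion W (((3 : ℕ) : ℤ) ^ k * ((3 : ℕ) : ℤ)),
      (∀ σ : absoluteGaloisGroup ℚ,
        W.torsionGaloisModule (((3 : ℕ) : ℤ) ^ k * ((3 : ℕ) : ℤ)) σ P = P) → P = 0) :
    Function.Injective (galoisCohomology.map (W.torsionInclusion (three_dvd_pow_succ_mul k)) 1) := by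
  refine (injective_iff_map_eq_zero _).mpr fun x hx => ?_
  obtain ⟨v, hv⟩ := (isSES_torsionInclusion_red W k red hred).exists_δ₀_eq_of_map_one_eq_zero x hx
  have hv0 : v = 0 := by
    apply Subtype.ext
    exact h0 v.1 fun σ => v.2 σ
  rw [← hv, hv0]
  exact map_zero _

/-! ### §2 The Selmer structures along `red` and `incl` -/

omit [W.IsElliptic] in
include hred in
/-- The specification of `red` in the spelling of n1011-p11's transport lemmas (`3^{(k+1)−k} = 3`).
[folklore] -/
theorem hred_pow (x : geomTorsion W (((3 : ℕ) : ℤ) ^ (k + 1) * ((3 : ℕ) : ℤ))) :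
    ((red x : geomTorsion W (((3 : ℕ) : ℤ) ^ k * ((3 : ℕ) : ℤ))) : geomPoints W) =
      (((3 : ℕ) : ℤ) ^ ((k + 1) - k)) • (x : geomPoints W) := by
  rw [hred, Nat.add_sub_cancel_left, pow_one]

include hred in
/-- **`red_*` maps `𝓕_can(E[3^{k+1}·3])` into `𝓕_can(E[3^k·3])` at every place** (`red ∘ π_{k+2} =
π_{k+1}` on crossed homomorphisms `Γ_{ℚ_v} → T_3E`, n1011-p11 `Transport.localMap_red_tateLocalMap`).
The hypothesis `hFπ` of the dévissage. [cite: Rubin2011, §3.1 (p. 29)] -/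
theorem localMap_red_mem_propagatedSelmerStructure (v : Place ℚ)
    {y : galoisCohomology ((W.torsionGaloisModule (((3 : ℕ) : ℤ) ^ (k + 1) * ((3 : ℕ) : ℤ))).toLocal v) 1}
    (hy : y ∈ propagatedSelmerStructure W 3 (k + 1) v) :
    localMap red v y ∈ propagatedSelmerStructure W 3 k v := by
  haveI : Fact (Nat.Prime 3) := ⟨Nat.prime_three⟩
  obtain ⟨z, rfl⟩ := (mem_propagatedSelmerStructure_iff W 3 (k + 1) v y).mp hy
  obtain ⟨η, rfl⟩ := oneCocycleClass_surjective (tateLocalRep W 3 v).toTopRep z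
  exact (mem_propagatedSelmerStructure_iff W 3 k v _).mpr ⟨oneCocycleClass (tateLocalRep W 3 v).toTopRep η,
    (Transport.localMap_red_tateLocalMap W (k := k) (k' := k + 1) (Nat.le_succ k) red
      (hred_pow W k red hred) v η).symm⟩

/-- **`incl_*⁻¹ 𝓕_can(E[3^{k+1}·3]) ⊆ 𝓕̄_can(E[3])` at every place** (n1011-p13: the propagated
structure is CARTESIAN, `isCartesianAt_propagatedSelmerStructure`, and its residual structure along
`[3^{k+1}]` is `propagatedSelmerStructureOne`, `induced_propagatedSelmerStructure`).  The hypothesis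
`hFi` of the dévissage. [cite: Sakamoto2024, Def. 3.5 (p. 923)] -/
theorem mem_propagatedSelmerStructureOne_of_localMap_torsionInclusion_mem (v : Place ℚ)
    (x : galoisCohomology ((W.torsionGaloisModule ((3 : ℕ) : ℤ)).toLocal v) 1)
    (hx : localMap (W.torsionInclusion (three_dvd_pow_succ_mul k)) v x ∈
      propagatedSelmerStructure W 3 (k + 1) v) :
    x ∈ propagatedSelmerStructureOne W 3 v := by
  haveI : Fact (Nat.Prime 3) := ⟨Nat.prime_three⟩
  rw [← induced_propagatedSelmerStructure W 3 (k + 1)]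
  exact isCartesianAt_propagatedSelmerStructure W 3 (k + 1) v x hx

/-- **`𝓕_can(E[3^{k+1}·3])_q ≤ H¹_ur` at a good prime `q ∤ 3`** (n1011-p13/p05
`propagatedSelmerStructure_inr_eq_unramifiedSubgroup`).  The hypothesis `hur₂`. [cite: Rubin2011, §3.1 (p. 29)] -/
theorem propagatedSelmerStructure_le_unramifiedSubgroup {q : HeightOneSpectrum (𝓞 ℚ)}
    (h3q : ((3 : ℕ) : 𝓞 ℚ) ∉ q.asIdeal) (hq : W.HasGoodReductionAt q) (j : ℕ) :
    propagatedSelmerStructure W 3 j (Sum.inr q) ≤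
      unramifiedSubgroup (GaloisRep.toLocal q (W.torsionGaloisModule (((3 : ℕ) : ℤ) ^ j * ((3 : ℕ) : ℤ)))) 1 := by
  haveI : Fact (Nat.Prime 3) := ⟨Nat.prime_three⟩
  exact (propagatedSelmerStructure_inr_eq_unramifiedSubgroup W 3 j h3q hq).le

/-- **`𝓕̄_can(E[3])_q ≤ H¹_ur` at a good prime `q ∤ 3`**: `𝓕̄_can = [3^{k+1}]_* 𝓕_can(E[3^{k+1}·3])`
(`induced_propagatedSelmerStructure`) and equivariant maps preserve unramified classes.  The
hypothesis `hur₁`. [cite: Rubin2011, §3.1 (p. 29)] -/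
theorem propagatedSelmerStructureOne_le_unramifiedSubgroup {q : HeightOneSpectrum (𝓞 ℚ)}
    (h3q : ((3 : ℕ) : 𝓞 ℚ) ∉ q.asIdeal) (hq : W.HasGoodReductionAt q) :
    propagatedSelmerStructureOne W 3 (Sum.inr q) ≤
      unramifiedSubgroup (GaloisRep.toLocal q (W.torsionGaloisModule ((3 : ℕ) : ℤ))) 1 := by
  haveI : Fact (Nat.Prime 3) := ⟨Nat.prime_three⟩
  intro x hx
  rw [← induced_propagatedSelmerStructure W 3 0] at hx
  obtain ⟨y, hy, rfl⟩ := (SelmerStructure.mem_induced_iff _ _ _ x).mp hx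
  exact localMap_mem_unramifiedSubgroup _ q (propagatedSelmerStructure_le_unramifiedSubgroup W h3q hq 0 hy)

/-! ### §3 Local injectivity of `incl_*` at a Kolyvagin prime of level `3^{k+2}` -/

omit [W.IsElliptic] in
include hred in
/-- **Local injectivity of `incl_* : H¹(ℚ_q, E[3]) → H¹(ℚ_q, E[3^{k+1}·3])`** when
`#H⁰(ℚ_q, E[3^{k+1}·3]) = 3^{k+2}`, `#H⁰(ℚ_q, E[3^k·3]) = 3^{k+1}` and `#H⁰(ℚ_q, E[3]) = 3` (a Kolyvagin
prime of level `3^{k+2}`): the kernel is `δ₀(H⁰(ℚ_q, E[3^k·3]))`, and `red : H⁰(ℚ_q, E[3^{k+1}·3]) →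
H⁰(ℚ_q, E[3^k·3])` is ONTO since its kernel injects into `H⁰(ℚ_q, E[3])` (counting). n1011-p15's
`localMap_torsionInclusion_injective` one level up. [cite: Rubin2011, Prop. 1.4.13 (1) (p. 9)]
[cite: SerreGaloisCohomology1997, I §2.2] -/
theorem localMap_torsionInclusion_injective (q : HeightOneSpectrum (𝓞 ℚ))
    (hN : Nat.card (GaloisRep.toLocal q
      (W.torsionGaloisModule (((3 : ℕ) : ℤ) ^ (k + 1) * ((3 : ℕ) : ℤ)))).toTopRep.ρ.invariants = 3 ^ (k + 2))
    (hd : Nat.card (GaloisRep.toLocal q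
      (W.torsionGaloisModule (((3 : ℕ) : ℤ) ^ k * ((3 : ℕ) : ℤ)))).toTopRep.ρ.invariants = 3 ^ (k + 1))
    (h3 : Nat.card (GaloisRep.toLocal q (W.torsionGaloisModule ((3 : ℕ) : ℤ))).toTopRep.ρ.invariants = 3) :
    Function.Injective (localMap (W.torsionInclusion (three_dvd_pow_succ_mul k)) (Sum.inr q)) := by
  set L := q.adicCompletion ℚ
  have hSES := (isSES_torsionInclusion_red W k red hred).restrictField L
  set ρN := GaloisRep.toLocal q (W.torsionGaloisModule (((3 : ℕ) : ℤ) ^ (k + 1) * ((3 : ℕ) : ℤ))) with hρN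
  set ρd := GaloisRep.toLocal q (W.torsionGaloisModule (((3 : ℕ) : ℤ) ^ k * ((3 : ℕ) : ℤ))) with hρd
  set ρ₃ := GaloisRep.toLocal q (W.torsionGaloisModule ((3 : ℕ) : ℤ)) with hρ₃
  set incl := W.torsionInclusion (three_dvd_pow_succ_mul k) with hincl
  have h3pos : 0 < 3 ^ (k + 2) := pow_pos (by norm_num) _
  haveI : Finite ρN.toTopRep.ρ.invariants := Nat.finite_of_card_ne_zero (by rw [hN]; exact h3pos.ne')
  haveI : Finite ρd.toTopRep.ρ.invariants :=
    Nat.finite_of_card_ne_zero (by rw [hd]; exact (pow_pos (by norm_num) _).ne')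
  haveI : Finite ρ₃.toTopRep.ρ.invariants := Nat.finite_of_card_ne_zero (by rw [h3]; norm_num)
  -- `red` on invariants
  have hmem : ∀ w : ρN.toTopRep.ρ.invariants, red w.1 ∈ ρd.toTopRep.ρ.invariants := fun w σ => by
    have h := red.isIntertwining (absGaloisRestrict ℚ L σ) w.1
    change (W.torsionGaloisModule (((3 : ℕ) : ℤ) ^ k * ((3 : ℕ) : ℤ))).toContRepresentation
      (absGaloisRestrict ℚ L σ) (red w.1) = red w.1
    rw [← h]
    exact congrArg red (w.2 σ)
  let r : ρN.toTopRep.ρ.invariants →+ ρd.toTopRep.ρ.invariants :=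
    { toFun := fun w => ⟨red w.1, hmem w⟩
      map_zero' := Subtype.ext (map_zero red)
      map_add' := fun a b => Subtype.ext (map_add red a.1 b.1) }
  -- the kernel of `r` injects into the invariants of `E[3]`
  have hker : Nat.card r.ker ≤ 3 := by
    refine le_of_le_of_eq ?_ h3
    have hlift : ∀ w : r.ker, ∃ u : ρ₃.toTopRep.ρ.invariants, incl u.1 = w.1.1 := by
      intro w
      have hw0 : red w.1.1 = 0 := congrArg Subtype.val ((AddMonoidHom.mem_ker).mp w.2)
      obtain ⟨u, hu⟩ := (isSES_torsionInclusion_red W k red hred).exact_mid w.1.1 hw0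
      refine ⟨⟨u, fun σ => ?_⟩, hu⟩
      apply (isSES_torsionInclusion_red W k red hred).injective
      change incl ((W.torsionGaloisModule ((3 : ℕ) : ℤ)).toContRepresentation
        (absGaloisRestrict ℚ L σ) u) = incl u
      rw [incl.isIntertwining]
      have hw := w.1.2 σ
      change (W.torsionGaloisModule (((3 : ℕ) : ℤ) ^ (k + 1) * ((3 : ℕ) : ℤ))).toContRepresentation
        (absGaloisRestrict ℚ L σ) w.1.1 = w.1.1 at hw
      rw [← hu] at hw
      exact hw
    choose lift hlift using hlift
    refine Nat.card_le_card_of_injective lift fun a b hab => ?_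
    apply Subtype.ext; apply Subtype.ext
    rw [← hlift a, ← hlift b, hab]
  -- counting: `3^{k+2} = #range · #ker`, `#range ≤ 3^{k+1}`, `#ker ≤ 3`
  have hcard : Nat.card ρN.toTopRep.ρ.invariants = Nat.card r.range * Nat.card r.ker := by
    rw [AddSubgroup.card_eq_card_quotient_mul_card_addSubgroup r.ker,
      Nat.card_congr (QuotientAddGroup.quotientKerEquivRange r).toEquiv]
  have hrange : Nat.card r.range = Nat.card ρd.toTopRep.ρ.invariants := by
    refine le_antisymm (AddSubgroup.card_le_card_addGroup r.range) ?_
    have h1 : Nat.card ρN.toTopRep.ρ.invariants = Nat.card r.range * Nat.card r.ker := hcard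
    rw [hN] at h1
    rw [hd]
    have h2 : 3 ^ (k + 1) * 3 ≤ Nat.card r.range * 3 :=
      calc 3 ^ (k + 1) * 3 = 3 ^ (k + 2) := (pow_succ 3 (k + 1)).symm
        _ = Nat.card r.range * Nat.card r.ker := h1
        _ ≤ Nat.card r.range * 3 := Nat.mul_le_mul_left _ hker
    exact Nat.le_of_mul_le_mul_right h2 (by norm_num)
  have hsurj : Function.Surjective r := by
    rw [← AddMonoidHom.range_eq_top, ← AddSubgroup.card_eq_iff_eq_top]
    exact hrange
  -- `δ₀ = 0`, so `incl_*` is injective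
  refine (injective_iff_map_eq_zero _).mpr fun x hx => ?_
  obtain ⟨v, hv⟩ := hSES.exists_δ₀_eq_of_map_one_eq_zero x hx
  obtain ⟨w, hw⟩ := hsurj v
  have hδ : hSES.δ₀ v = 0 :=
    (hSES.δ₀_eq_zero_iff v).mpr ⟨w.1, w.2, by rw [← hw]; rfl⟩
  exact hv.symm.trans hδ

/-! ### §4 Matched bases -/

/-- The `ℤ/3^{j+1}`-rank of `E[3^j·3]` is `2`. [cite: SilvermanAEC2009, Cor. III.6.4(b)] -/
theorem finrank_geomTorsion_pow_mul (j : ℕ) :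
    Module.finrank (ZMod (3 ^ (j + 1))) (geomTorsion W (((3 : ℕ) : ℤ) ^ j * ((3 : ℕ) : ℤ))) = 2 := by
  haveI : Fact (Nat.Prime 3) := ⟨Nat.prime_three⟩
  haveI : Fact (1 < 3 ^ (j + 1)) := ⟨Nat.one_lt_pow (Nat.succ_ne_zero _) (by norm_num)⟩
  obtain ⟨e⟩ := nonempty_linearEquiv_prod_geomTorsion W 3 j
  rw [← e.finrank_eq, Module.finrank_prod, Module.finrank_self]

include hred in
/-- **A `ℤ/3^{k+2}`-basis of `E[3^{k+1}·3]` maps under `red` to a `ℤ/3^{k+1}`-basis of `E[3^k·3]`**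
(both free of rank `2`, `red` onto and semilinear): the basis hypothesis of n1011-p15's
`singularMap_localMap_eq_fs_of_hasCanonicalComparison` for the pair `(E[3^{k+1}·3], E[3^k·3])`.
[cite: SilvermanAEC2009, Cor. III.6.4(b)] -/
theorem exists_bases_red :
    ∃ (n : ℕ) (b : Basis (Fin n) (ZMod (3 ^ (k + 1 + 1))) (geomTorsion W (((3 : ℕ) : ℤ) ^ (k + 1) * ((3 : ℕ) : ℤ))))
      (b' : Basis (Fin n) (ZMod (3 ^ (k + 1))) (geomTorsion W (((3 : ℕ) : ℤ) ^ k * ((3 : ℕ) : ℤ)))),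
      ∀ i, red (b i) = b' i := by
  classical
  haveI : Fact (Nat.Prime 3) := ⟨Nat.prime_three⟩
  haveI : NeZero (3 ^ (k + 1 + 1)) := ⟨pow_ne_zero _ (by norm_num)⟩
  haveI : Fact (1 < 3 ^ (k + 1 + 1)) := ⟨Nat.one_lt_pow (Nat.succ_ne_zero _) (by norm_num)⟩
  haveI : Fact (1 < 3 ^ (k + 1)) := ⟨Nat.one_lt_pow (Nat.succ_ne_zero _) (by norm_num)⟩
  let b₀ := Module.Free.chooseBasis (ZMod (3 ^ (k + 1 + 1)))
    (geomTorsion W (((3 : ℕ) : ℤ) ^ (k + 1) * ((3 : ℕ) : ℤ)))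
  let b := b₀.reindex (Fintype.equivFin _)
  have hcard : Fintype.card (Fin (Fintype.card (Module.Free.ChooseBasisIndex (ZMod (3 ^ (k + 1 + 1)))
      (geomTorsion W (((3 : ℕ) : ℤ) ^ (k + 1) * ((3 : ℕ) : ℤ)))))) =
      Module.finrank (ZMod (3 ^ (k + 1))) (geomTorsion W (((3 : ℕ) : ℤ) ^ k * ((3 : ℕ) : ℤ))) := by
    rw [Fintype.card_fin, ← Module.finrank_eq_card_chooseBasisIndex, finrank_geomTorsion_pow_mul W (k + 1),
      finrank_geomTorsion_pow_mul W k]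
  have hspan : ⊤ ≤ Submodule.span (ZMod (3 ^ (k + 1))) (Set.range fun i => red (b i)) := by
    rintro x -
    obtain ⟨y, hy⟩ := (isSES_torsionInclusion_red W k red hred).surjective x
    have hy' : red y = x := hy
    rw [← hy', ← b.sum_repr y, map_sum]
    refine Submodule.sum_mem _ fun i _ => ?_
    rw [map_zmod_smul_eq_castHom_smul (pow_dvd_pow 3 (Nat.le_succ (k + 1))) red]
    exact Submodule.smul_mem _ _ (Submodule.subset_span ⟨i, rfl⟩)
  exact ⟨_, b, basisOfTopLeSpanOfCardEqFinrank (fun i => red (b i)) hspan hcard, fun i => by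
    rw [coe_basisOfTopLeSpanOfCardEqFinrank]⟩

/-- **A `ℤ/3^{k+2}`-basis of `E[3^{k+1}·3]` maps under `[3^{k+1}]` to an `𝔽₃`-basis of `E[3]`** (n1011-p15's
`exists_bases_torsionMulBy_three` one level up): the basis hypothesis of
`singularMap_eq_fs_of_localMap_of_hasCanonicalComparison` for the pair `(E[3^{k+1}·3], E[3])`.
[cite: SilvermanAEC2009, Cor. III.6.4(b)] -/
theorem exists_bases_torsionMulBy :
    ∃ (n : ℕ) (b : Basis (Fin n) (ZMod (3 ^ (k + 1 + 1))) (geomTorsion W (((3 : ℕ) : ℤ) ^ (k + 1) * ((3 : ℕ) : ℤ))))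
      (b' : Basis (Fin n) (ZMod 3) (geomTorsion W ((3 : ℕ) : ℤ))),
      ∀ i, W.torsionMulBy (((3 : ℕ) : ℤ) ^ (k + 1)) ((3 : ℕ) : ℤ) (b i) = b' i := by
  classical
  haveI : Fact (Nat.Prime 3) := ⟨Nat.prime_three⟩
  haveI : NeZero (3 ^ (k + 1 + 1)) := ⟨pow_ne_zero _ (by norm_num)⟩
  haveI : Fact (1 < 3 ^ (k + 1 + 1)) := ⟨Nat.one_lt_pow (Nat.succ_ne_zero _) (by norm_num)⟩
  haveI : Finite (geomTorsion W ((3 : ℕ) : ℤ)) := finite_geomTorsion_of_neZero W 3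
  haveI : Module.Finite (ZMod 3) (geomTorsion W ((3 : ℕ) : ℤ)) := Module.Finite.of_finite
  set red₁ := W.torsionMulBy (((3 : ℕ) : ℤ) ^ (k + 1)) ((3 : ℕ) : ℤ) with hred₁
  let b₀ := Module.Free.chooseBasis (ZMod (3 ^ (k + 1 + 1)))
    (geomTorsion W (((3 : ℕ) : ℤ) ^ (k + 1) * ((3 : ℕ) : ℤ)))
  let b := b₀.reindex (Fintype.equivFin _)
  have h3 : Module.finrank (ZMod 3) (geomTorsion W ((3 : ℕ) : ℤ)) = 2 := by
    have h3Q : ((3 : ℕ) : AlgebraicClosure ℚ) ≠ 0 := by norm_num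
    have hcard : Nat.card (geomTorsion W ((3 : ℕ) : ℤ)) = 3 ^ 2 :=
      card_torsionPoints_eq_sq_holds W (AlgebraicClosure ℚ) h3Q
    have h := Module.natCard_eq_pow_finrank (K := ZMod 3) (V := geomTorsion W ((3 : ℕ) : ℤ))
    rw [hcard, Nat.card_zmod] at h
    exact (Nat.pow_right_injective (by norm_num : 2 ≤ 3) h).symm
  have hcard : Fintype.card (Fin (Fintype.card (Module.Free.ChooseBasisIndex (ZMod (3 ^ (k + 1 + 1)))
      (geomTorsion W (((3 : ℕ) : ℤ) ^ (k + 1) * ((3 : ℕ) : ℤ)))))) =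
      Module.finrank (ZMod 3) (geomTorsion W ((3 : ℕ) : ℤ)) := by
    rw [Fintype.card_fin, ← Module.finrank_eq_card_chooseBasisIndex, finrank_geomTorsion_pow_mul W (k + 1), h3]
  have hspan : ⊤ ≤ Submodule.span (ZMod 3) (Set.range fun i => red₁ (b i)) := by
    rintro x -
    obtain ⟨y, hy⟩ := torsionMulBy_pow_surjective W 3 (k + 1) x
    rw [← hy, ← b.sum_repr y, map_sum]
    refine Submodule.sum_mem _ fun i _ => ?_
    rw [map_zmod_smul_eq_castHom_smul (dvd_pow_self 3 (Nat.succ_ne_zero _)) red₁]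
    exact Submodule.smul_mem _ _ (Submodule.subset_span ⟨i, rfl⟩)
  exact ⟨_, b, basisOfTopLeSpanOfCardEqFinrank (fun i => red₁ (b i)) hspan hcard, fun i => by
    rw [coe_basisOfTopLeSpanOfCardEqFinrank]⟩

end Summit.BirchSwinnertonDyer.Rank1Residual.GaloisImage.TorsionLevel

end
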